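import Summits.QuantumFields.BalabanUV.T4Continuum.Spine.NE1p.DressedSmallFieldMixedLetter
import Literature.MathematicalPhysics.QuantumFieldTheory.Dimock2011to13.PolydiscCauchyBounds

/-!
# T⁴ programme, spine estimate NE1′ (node O3b/H2) — THE SUBSTRATE's CONTOUR LETTERS ARE DIMOCK's `∂∕∂s_{Z−Y}`, part 1 (THE BRIDGE):
# Dimock's kernel mixed derivative `PolydiscCauchyBounds.mixedDeriv` ([Dimock2013] §4.5 Lemma 19, `update`-slices, list-indexed) read
# along W39.1's `Fin.cons` recursion over an active set `S` of cubes — enumeration, base point, unfolding, the ENTIRE head section BY NAME,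
# and the product face (W34's per-cube derivative letters)

Cell `pub-balaban`, sub-cell `t4`, row NE1′ formalisation crew (`t4/formal/NE1p/LEAVES.md` row W55 ∕ DAG N29zzza as pre-assigned by typer R-T129 —
own-initiative witness under R-T61 (ii); INTENT journal HOME/CLAIMS.log l.20319, RE-SCOPED to the BRIDGE shape by the AMENDMENT l.20343; (D1) TWO
PARTS, part 2 = `DressedSmallFieldMixedDerivativeLetter`), unit `b2b-balaban-t4-ne1p-formalise-leaf-08` (gen 11).  ADDITIVE — imports THIS
LINEAGE's W39.1 `Spine/NE1p/DressedSmallFieldMixedLetter` (leaf-08 g10, p228238: `tailSet`, `mem_tailSet`, `prod_mem_succ`, `differentiable_cons_left`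
BY NAME) AND the template lineage's Literature module `Literature/MathematicalPhysics/QuantumFieldTheory/Dimock2011to13/PolydiscCauchyBounds`
(unit `b2b-balaban-template` g31, p204781 + v1.1; [cite: Dimock2013 §4.5]: `pderiv`, `mixedDeriv`, `mixedDeriv_nil`, `mixedDeriv_cons`,
**`analyticOnNhd_mixedDeriv`** BY NAME — first NE1′ consumer; it imports Mathlib only, no cycle) ONLY.  TWO dictionary DATA `def`s (`enumS`,
`basePt`) + theorems; 0 `def … : Prop`, 0 cite, 0 sorry, 0 `attribute`; NOTHING of W39.1 ∕ the Literature module restated — in particular NO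
second mixed-derivative object and NO Cauchy estimate of Lemma-19 kind is declared (Dimock's `lemma19_cauchy` IS that bound).

WHY THIS FILE.  [Balaban1988RGII] p. 7: «We differentiate it with respect to t_□, at t_□ = 0, and we represent all derivatives by the
Cauchy formula», (1.23) «Π_{Δ⊂Y₀∖□̃⁴} ∫ ds(Δ) (1∕2πi) ∫ dσ(Δ)∕(σ(Δ) − s(Δ))² · E(…)» «where … the σ(Δ)-integrations are over the circles
|σ(Δ)| = e^{κ₁}»; p. 15 (2.14) the same operator per cube, «We consider it as an analytic function of (U,J) …, and of the complex parameters
σ(Z), τ» — LOCI of the audited manuscript, TYPE∕CONTEXT only.  The Dimock TEMPLATE writes this step with DERIVATIVES `∂∕∂s_{Z−Y}` and «Cauchy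
bounds» ([Dimock2013] §4.5 Lemma 19; kernel: `PolydiscCauchyBounds`, `mixedDeriv (i :: l) g = pderiv i (mixedDeriv l g)`, `pderiv i g s =
deriv (t ↦ g (update s i t)) (s i)`), the NE5 substrate and this lineage's W39.1 encode Bałaban's CONTOUR form along `Fin.cons` (active set `S`,
inactive cubes frozen at `0`).  Part 2 proves that the `θ`-section of W39.1's letter IS Dimock's mixed derivative; this part supplies the bridge:
* `pderiv_zero_cons`, `pderiv_succ_cons`, **`mixedDeriv_map_succ_cons`** (`∂_{l.map succ} G (t ∷ w) = ∂_l (G(t ∷ ·))(w)` — Mathlib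
  `Fin.update_cons_zero`∕`Fin.cons_update`); the increasing enumeration `enumS n S` of the active cubes (`mem_enumS`, `enumS_nodup`,
  `length_enumS = #S` — so Dimock's `lemma19_cauchy` applies to `enumS S` verbatim); the base point `basePt S s = (s_j on S, 0 off S)`; the
  unfoldings `mixedDeriv_enumS_zero`∕`_succ_of_mem`∕`_succ_of_not_mem` (W39.1's recursion shape for Dimock's object);
* **`differentiable_mixedDeriv_cons`**: the head section `z ↦ ∂_l(F(z ∷ ·))(p)` of a jointly entire `F` is entire — Dimock's
  `analyticOnNhd_mixedDeriv` ∘ W39.1's `differentiable_cons_left`, BY NAME (no several-variables lemma is proved here); `analyticOnNhd_apply`,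
  `analyticOnNhd_cons_section` (sections are jointly analytic: Mathlib `AnalyticOnNhd.pi` + `ContinuousLinearMap.proj`);
* `mixedDeriv_enumS_const_mul` and **`mixedDeriv_enumS_prod`**: on a PRODUCT of cube factors `∂_{enumS S}` at `basePt S s` is
  `Π_{j∈S} G_j′(s_j)` — W34's per-cube `cubeLetter_inner_eq_deriv` is the product case.

HONEST FRAMING.  [folklore] bookkeeping of slice derivatives along `Fin.cons` + by-name composition (Dimock's analyticity of mixed derivatives,
W39.1's affine insertions); `enumS`∕`basePt` are OUR dictionary; the identification of `F` with print's s(Δ)-dependent operator products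
((1.10)∕(1.23)∕(2.7)∕(2.14)) is a TYPE READING; the hypothesis of `differentiable_mixedDeriv_cons` is JOINT analyticity on ALL of `ℂⁿ⁺¹`
(`AnalyticOnNhd ℂ F univ`, print's word «analytic»; Mathlib has no Osgood lemma upgrading joint `Differentiable` on `ℂⁿ`) — print's TYPE is a
neighbourhood of the closed polydisc, the LOCAL version is NOT claimed; no numeral of [Balaban1988RGII] asserted (k2); (B1) for Bałaban's (2.14) NOT discharged; (B3) = GAPS G-ne9p2-5
UNPRINTED — NOT discharged, untouched; (B5) untouched; 0 binders instantiated on Bałaban's densities ∕ operators ∕ (2.14) data ∕ `d_k` ∕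
minimisers ∕ backgrounds; discharges no wall item; wall v1.7 (T4-DAG v46) does NOT move; R-t4r2-Q2 NOT met thereby; NE1′ ⇐ the named
binders — NOT proved, NOT printed; spine PROVED 0∕9; count 9 unchanged.  Rung (B)+1 on ONE finite four-torus — NOT infinite volume, NOT a
mass gap, NOT OS on ℝ⁴, NOT Clay.  ABSOLUTE RULE honoured: the quotations are LOCI of the audited manuscript [Balaban1988RGII] (CMP 116 (1988) 1–22, pp. 7, 15),
TYPE∕CONTEXT only, never hypothesis-free facts; [Dimock2013] enters only through the cite-tagged Literature module BY NAME; nothing internally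
minted is cited; [folklore] tags on kernel lemmas only.  HONEST DEPENDENCY: continuum YM on T⁴ ⇐ BetaPertH ∧ nine spine estimates (0/9 proved); BetaPertH ⇐ (D1) ∧ (D4) ∧
CAP+tail; G-an2-4 gates asym, D1 and NE2/3/4.
-/

noncomputable section

namespace Summit.QuantumFields.BalabanUV.T4Continuum.NE1p.DressedSmallFieldMixedDerivativeBridge

open Set Complex Finset Function
open scoped BigOperators
open Summit.QuantumFields.BalabanUV.T4Continuum.NE1p.DressedSmallFieldMixedLetter
open Literature.MathematicalPhysics.QuantumFieldTheory.Dimock2011to13.PolydiscCauchyBounds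
  (pderiv mixedDeriv mixedDeriv_nil mixedDeriv_cons analyticOnNhd_mixedDeriv)

variable {n : ℕ}

/-! ## §1 BRIDGE: Dimock's `update`-slice derivatives `pderiv`∕`mixedDeriv` along W39.1's `Fin.cons` recursion -/

/-- [folklore] The slice derivative in the HEAD variable is the derivative of the head section (`Fin.update_cons_zero`). -/
theorem pderiv_zero_cons (G : (Fin (n + 1) → ℂ) → ℂ) (t : ℂ) (w : Fin n → ℂ) :
    pderiv 0 G (Fin.cons t w) = deriv (fun z : ℂ => G (Fin.cons z w)) t := by
  simp only [pderiv, Fin.update_cons_zero, Fin.cons_zero]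

/-- [folklore] A slice derivative in a TAIL variable is the slice derivative of the head section (`Fin.cons_update`). -/
theorem pderiv_succ_cons (j : Fin n) (G : (Fin (n + 1) → ℂ) → ℂ) (t : ℂ) (w : Fin n → ℂ) :
    pderiv j.succ G (Fin.cons t w) = pderiv j (fun w => G (Fin.cons t w)) w := by
  simp only [pderiv, ← Fin.cons_update, Fin.cons_succ]

/-- [folklore] **Mixed derivatives in TAIL variables are the mixed derivatives of the head section**:
`∂_{l.map succ} G (t ∷ w) = ∂_l (G(t ∷ ·))(w)`. -/
theorem mixedDeriv_map_succ_cons (G : (Fin (n + 1) → ℂ) → ℂ) (t : ℂ) :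
    ∀ (l : List (Fin n)) (w : Fin n → ℂ),
      mixedDeriv (l.map Fin.succ) G (Fin.cons t w) = mixedDeriv l (fun w => G (Fin.cons t w)) w
  | [], w => by simp
  | j :: l, w => by
      rw [List.map_cons, mixedDeriv_cons, mixedDeriv_cons, pderiv_succ_cons]
      congr 1
      funext y
      exact mixedDeriv_map_succ_cons G t l y

/-- The active cubes ENUMERATED increasingly along `Fin.cons` — the list fed to Dimock's list-indexed `mixedDeriv` (head = outermost
derivative). -/
def enumS : (n : ℕ) → Finset (Fin n) → List (Fin n)
  | 0, _ => []
  | n + 1, S =>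
      if (0 : Fin (n + 1)) ∈ S then (0 : Fin (n + 1)) :: (enumS n (tailSet S)).map Fin.succ
      else (enumS n (tailSet S)).map Fin.succ

/-- [folklore] `enumS` lists exactly the active cubes. -/
theorem mem_enumS : ∀ (n : ℕ) (S : Finset (Fin n)) (j : Fin n), j ∈ enumS n S ↔ j ∈ S
  | 0, _, j => j.elim0
  | n + 1, S, j => by
      induction j using Fin.cases with
      | zero => by_cases h : (0 : Fin (n + 1)) ∈ S <;> simp [enumS, h, Fin.succ_ne_zero]
      | succ i =>
          have ih := mem_enumS n (tailSet S) i
          rw [mem_tailSet] at ih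
          by_cases h : (0 : Fin (n + 1)) ∈ S
          · simp [enumS, h, ih, Fin.succ_ne_zero]
          · simp [enumS, h, ih]

/-- [folklore] … without repetition (so Dimock's `norm_mixedDeriv_le`∕`lemma19_cauchy` apply to it verbatim). -/
theorem enumS_nodup : ∀ (n : ℕ) (S : Finset (Fin n)), (enumS n S).Nodup
  | 0, _ => List.nodup_nil
  | n + 1, S => by
      have ht : ((enumS n (tailSet S)).map Fin.succ).Nodup := (enumS_nodup n _).map (Fin.succ_injective n)
      by_cases h : (0 : Fin (n + 1)) ∈ S
      · simp only [enumS, if_pos h, List.nodup_cons]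
        exact ⟨by simp [Fin.succ_ne_zero], ht⟩
      · simp only [enumS, if_neg h]; exact ht

/-- [folklore] … and has `#S` entries (the exponent of Lemma 19's `e^{−(κ₁−1)·|l|}`). -/
theorem length_enumS (n : ℕ) (S : Finset (Fin n)) : (enumS n S).length = S.card := by
  have h : (enumS n S).toFinset = S := Finset.ext fun j => by simp [mem_enumS]
  rw [← List.toFinset_card_of_nodup (enumS_nodup n S), h]

/-- THE BASE POINT of the derivative: `s_j` on an active cube, the decoupled value `0` on an inactive one (as W39.1's `σS` freezes inactive
cubes at `0`). -/
def basePt (S : Finset (Fin n)) (s : Fin n → ℝ) : Fin n → ℂ := fun j => if j ∈ S then ((s j : ℝ) : ℂ) else 0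

/-- [folklore] The base point along `Fin.cons`. -/
theorem basePt_eq_cons (S : Finset (Fin (n + 1))) (s : Fin (n + 1) → ℝ) :
    basePt S s = Fin.cons (if (0 : Fin (n + 1)) ∈ S then ((s 0 : ℝ) : ℂ) else 0) (basePt (tailSet S) (Fin.tail s)) := by
  funext j
  induction j using Fin.cases with
  | zero => simp [basePt]
  | succ i => simp [basePt, Fin.tail]

/-- [folklore] No cube: `∂_{[]} F = F` at the (unique) point of `ℂ⁰`. -/
theorem mixedDeriv_enumS_zero (S : Finset (Fin 0)) (F : (Fin 0 → ℂ) → ℂ) (s : Fin 0 → ℝ) :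
    mixedDeriv (enumS 0 S) F (basePt S s) = F fun i => i.elim0 := by
  rw [show enumS 0 S = [] from rfl, mixedDeriv_nil]
  exact congrArg F (funext fun i => i.elim0)

/-- [folklore] **UNFOLDING ALONG `Fin.cons`, head cube ACTIVE**: `∂_{enumS S} F (basePt S s) = (d∕dz)|_{z = s₀} ∂_{enumS S′}(F(z ∷ ·))(basePt S′ s′)`
— W39.1's recursion shape for Dimock's object. -/
theorem mixedDeriv_enumS_succ_of_mem {S : Finset (Fin (n + 1))} (h : (0 : Fin (n + 1)) ∈ S) (F : (Fin (n + 1) → ℂ) → ℂ)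
    (s : Fin (n + 1) → ℝ) :
    mixedDeriv (enumS (n + 1) S) F (basePt S s) =
      deriv (fun z : ℂ => mixedDeriv (enumS n (tailSet S)) (fun w => F (Fin.cons z w)) (basePt (tailSet S) (Fin.tail s)))
        ((s 0 : ℝ) : ℂ) := by
  rw [show enumS (n + 1) S = (0 : Fin (n + 1)) :: (enumS n (tailSet S)).map Fin.succ from if_pos h, mixedDeriv_cons, basePt_eq_cons,
    if_pos h, pderiv_zero_cons]
  simp only [mixedDeriv_map_succ_cons]

/-- [folklore] **… head cube INACTIVE**: `∂_{enumS S} F (basePt S s) = ∂_{enumS S′}(F(0 ∷ ·))(basePt S′ s′)`. -/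
theorem mixedDeriv_enumS_succ_of_not_mem {S : Finset (Fin (n + 1))} (h : (0 : Fin (n + 1)) ∉ S) (F : (Fin (n + 1) → ℂ) → ℂ)
    (s : Fin (n + 1) → ℝ) :
    mixedDeriv (enumS (n + 1) S) F (basePt S s) =
      mixedDeriv (enumS n (tailSet S)) (fun w => F (Fin.cons 0 w)) (basePt (tailSet S) (Fin.tail s)) := by
  rw [show enumS (n + 1) S = (enumS n (tailSet S)).map Fin.succ from if_neg h, basePt_eq_cons, if_neg h, mixedDeriv_map_succ_cons]

/-- **THE HEAD SECTION OF `∂_l` IS ENTIRE** — BY NAME: for `F` jointly analytic on `ℂⁿ⁺¹`, `z ↦ ∂_l(F(z ∷ ·))(p)` is complex differentiable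
on `ℂ` (Dimock's `analyticOnNhd_mixedDeriv` on `l.map succ` composed with W39.1's affine `differentiable_cons_left`; §1's bridge moves the
section inside) — exactly what the substrate's ONE-variable letter needs on the outer cube.  No several-variables lemma is proved here. [folklore] -/
theorem differentiable_mixedDeriv_cons {F : (Fin (n + 1) → ℂ) → ℂ} (hF : AnalyticOnNhd ℂ F univ) (l : List (Fin n)) (p : Fin n → ℂ) :
    Differentiable ℂ fun z : ℂ => mixedDeriv l (fun w => F (Fin.cons z w)) p := by
  have h : (fun z : ℂ => mixedDeriv l (fun w => F (Fin.cons z w)) p) = fun z => mixedDeriv (l.map Fin.succ) F (Fin.cons z p) := by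
    funext z; rw [mixedDeriv_map_succ_cons]
  rw [h]
  have hA := analyticOnNhd_mixedDeriv isOpen_univ hF (l.map Fin.succ)
  have hD : Differentiable ℂ (mixedDeriv (l.map Fin.succ) F) := fun x => (hA x (mem_univ _)).differentiableAt
  exact hD.comp (differentiable_cons_left p)

/-- [folklore] Coordinate functions are jointly analytic (Mathlib `ContinuousLinearMap.proj`). -/
theorem analyticOnNhd_apply (j : Fin n) : AnalyticOnNhd ℂ (fun z : Fin n → ℂ => z j) univ :=
  (ContinuousLinearMap.proj (R := ℂ) (φ := fun _ : Fin n => ℂ) j).analyticOnNhd univ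

/-- [folklore] Sections of a jointly analytic function along `Fin.cons` are jointly analytic (composition with the analytic insertion
`w ↦ c ∷ w`, coordinatewise by Mathlib `AnalyticOnNhd.pi`). -/
theorem analyticOnNhd_cons_section {F : (Fin (n + 1) → ℂ) → ℂ} (hF : AnalyticOnNhd ℂ F univ) (c : ℂ) :
    AnalyticOnNhd ℂ (fun w : Fin n → ℂ => F (Fin.cons c w)) univ := by
  have hins : AnalyticOnNhd ℂ (fun w : Fin n → ℂ => (Fin.cons c w : Fin (n + 1) → ℂ)) univ := by
    have h : ∀ i : Fin (n + 1), AnalyticOnNhd ℂ (fun w : Fin n → ℂ => (Fin.cons c w : Fin (n + 1) → ℂ) i) univ := by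
      intro i
      induction i using Fin.cases with
      | zero => simpa using (analyticOnNhd_const : AnalyticOnNhd ℂ (fun _ : Fin n → ℂ => c) univ)
      | succ j => simpa using analyticOnNhd_apply j
    exact AnalyticOnNhd.pi h
  exact hF.comp hins (Set.mapsTo_univ _ _)

/-- [folklore] `∂_{enumS S}` is linear: constants pull out (no differentiability needed over a field). -/
theorem mixedDeriv_enumS_const_mul : ∀ (n : ℕ) (S : Finset (Fin n)) (c : ℂ) (F : (Fin n → ℂ) → ℂ) (s : Fin n → ℝ),
    mixedDeriv (enumS n S) (fun z => c * F z) (basePt S s) = c * mixedDeriv (enumS n S) F (basePt S s)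
  | 0, S, c, F, s => by rw [mixedDeriv_enumS_zero, mixedDeriv_enumS_zero]
  | n + 1, S, c, F, s => by
      by_cases h : (0 : Fin (n + 1)) ∈ S
      · simp only [mixedDeriv_enumS_succ_of_mem h, mixedDeriv_enumS_const_mul n, deriv_const_mul_field]
      · simp only [mixedDeriv_enumS_succ_of_not_mem h, mixedDeriv_enumS_const_mul n]

/-- **W34's PER-CUBE DERIVATIVE LETTERS ARE THE PRODUCT CASE** [folklore]: for a factor that IS a product of one-variable cube factors over the
active cubes, `∂_{enumS S}(Π_{j∈S} G_j(z_j))(basePt S s) = Π_{j∈S} G_j′(s_j)` — W34's `cubeLetter_inner_eq_deriv` cube by cube. -/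
theorem mixedDeriv_enumS_prod : ∀ (n : ℕ) (S : Finset (Fin n)) (G : Fin n → ℂ → ℂ) (s : Fin n → ℝ),
    mixedDeriv (enumS n S) (fun z => ∏ j ∈ S, G j (z j)) (basePt S s) = ∏ j ∈ S, deriv (G j) ((s j : ℝ) : ℂ)
  | 0, S, G, s => by simp [mixedDeriv_enumS_zero, Finset.eq_empty_of_isEmpty S]
  | n + 1, S, G, s => by
      have hc : ∀ (c : ℂ) (z : Fin n → ℂ), ∏ j ∈ S, G j ((Fin.cons c z : Fin (n + 1) → ℂ) j) =
          (if (0 : Fin (n + 1)) ∈ S then G 0 c else 1) * ∏ j ∈ tailSet S, G j.succ (z j) := fun c z => by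
        rw [prod_mem_succ]; simp only [Fin.cons_zero, Fin.cons_succ]
      have ih := mixedDeriv_enumS_prod n (tailSet S) (fun j => G j.succ) (Fin.tail s)
      rw [prod_mem_succ S (fun j => deriv (G j) ((s j : ℝ) : ℂ))]
      by_cases h : (0 : Fin (n + 1)) ∈ S
      · simp only [mixedDeriv_enumS_succ_of_mem h, hc, if_pos h, mixedDeriv_enumS_const_mul, ih, deriv_mul_const_field, Fin.tail]
      · simp only [mixedDeriv_enumS_succ_of_not_mem h, hc, if_neg h, mixedDeriv_enumS_const_mul, ih, Fin.tail]

end Summit.QuantumFields.BalabanUV.T4Continuum.NE1p.DressedSmallFieldMixedDerivativeBridge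

end
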